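import Summits.QuantumFields.YangMills.Theorems.SwapVirialDeficitGnomonicJetFour
import Summits.QuantumFields.YangMills.Theorems.SwapVirialDeficitGnomonicJetLetters
import HarnessLib

/-!
# W4 (order-4 jets), part K2: THE RADIAL PROJECTION OF AN AFFINE LINE CARRIES A 4-JET `(a, a², 3a³, 9a⁴)`, `a = ‖w‖/‖u₀‖`
# (free-hands support of ⟨stmt-QuantumFields-24197⟩ `SwapVirialDeficit.SwapGluedStiffness`)

Order-four twin of ✓`…GnomonicJetLetters` (J2a), for LEAD g97's brick W4 (steep-window Morse–Bott, HOME `sfw-p2-g97-memo-24197-steep-window-morse-bott.md` §1).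
For `u₀ ≠ 0`, `w ⊥ u₀`, `r(t) = ‖u₀ + t w‖`, `B = ‖w‖²`, `X = Bt²`, `A = ‖u₀‖²` (`r² = A + X`):
* §1 `hasDerivAt_radialFactor₃` — `n‴ = 9B²t/r⁵ − 15B³t³/r⁷` has derivative `n⁗ = 9B²/r⁵ − 90B³t²/r⁷ + 105B⁴t⁴/r⁹`;
* §2 ★ `norm_radialJet₄_le` — `‖4n‴ w + n⁗ (u₀ + t w)‖ ≤ 9(‖w‖/‖u₀‖)⁴`: EXACTLY `‖q⁗‖² = 9AB⁴(9A³ + 72A²X − 48AX² + 64X³)/r¹⁶`, and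
  `A⁵(9A³ + 72A²X − 48AX² + 64X³) ≤ 9(A + X)⁸` (the difference is `300A⁶X² + 440A⁵X³ + 630A⁴X⁴ + 504A³X⁵ + 252A²X⁶ + 72AX⁷ + 9X⁸ ≥ 0`); in the scaling picture
  `‖f⁗(s)‖² = 9(9 + 72s² − 48s⁴ + 64s⁶)(1+s²)⁻⁸ ≤ 81` for `f(s) = (û₀ + sŵ)/√(1+s²)`;
* §3 ★★★ `jet4_radialUnit_affine` — `t ↦ radialUnit (u₀ + t • w)` carries a 4-jet of size `‖w‖/‖u₀‖` (J2a's three jets + the fourth).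
Part K3 transports this to the letters ∕ leaders ∕ followers of the gnomonic blow-up, K4–K5 to `|d⁴/dt⁴ qDeficit|`, K6 to the order-4 Taylor datum.

HONEST LABEL: calculus plumbing (no ring, no measure); nothing about ⟨24197⟩ (window-uniform, OPEN), (LW), (M), W3–W9 or any rung is proved; ⟨24194⟩ ∕ ⟨24196⟩ ∕
⟨24497⟩ OPEN; item of record ⟨24085⟩ SubOctaveBounded aside ∕ untouched; the Yang–Mills mass gap is NOT proved; no summit is proved by a line.  THEOREMS ONLY
(0 `def`, 0 `sorry`), standard axioms, no local instances.  Seat ym-line-fcl-p3 g47 (cell ym-idea-1, free hands), `--supports stmt-QuantumFields-24197`.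
References: [folklore].
-/

set_option autoImplicit false

noncomputable section

open Quaternion
open scoped Quaternion RealInnerProductSpace BigOperators
open Literature.Analysis.Calculus (radialUnit radialUnit_def norm_radialUnit)

namespace Summit.QuantumFields.YangMills.Theorems.SwapVirialDeficit.Gnomonic

/-! ## §1 The fourth derivative of the scalar factor -/

section Affine

variable {u₀ w : ℍ}

/-- `n‴(t) = 9‖w‖⁴t/r⁵ − 15‖w‖⁶t³/r⁷` has derivative `n⁗ = 9‖w‖⁴/r⁵ − 90‖w‖⁶t²/r⁷ + 105‖w‖⁸t⁴/r⁹`. [folklore] -/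
theorem hasDerivAt_radialFactor₃ (hu : u₀ ≠ 0) (hw : ⟪u₀, w⟫ = 0) (t : ℝ) :
    HasDerivAt (fun t : ℝ => 9 * ‖w‖ ^ 4 * t / ‖u₀ + t • w‖ ^ 5 - 15 * ‖w‖ ^ 6 * t ^ 3 / ‖u₀ + t • w‖ ^ 7)
      (9 * ‖w‖ ^ 4 / ‖u₀ + t • w‖ ^ 5 - 90 * ‖w‖ ^ 6 * t ^ 2 / ‖u₀ + t • w‖ ^ 7 + 105 * ‖w‖ ^ 8 * t ^ 4 / ‖u₀ + t • w‖ ^ 9) t := by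
  have hr : ‖u₀ + t • w‖ ≠ 0 := (norm_affine_pos hu hw t).ne'
  have hA : HasDerivAt (fun t : ℝ => 9 * ‖w‖ ^ 4 * t / ‖u₀ + t • w‖ ^ 5)
      ((9 * ‖w‖ ^ 4 * ‖u₀ + t • w‖ ^ 5 - 9 * ‖w‖ ^ 4 * t * (5 * ‖u₀ + t • w‖ ^ 4 * (‖w‖ ^ 2 * t / ‖u₀ + t • w‖))) / (‖u₀ + t • w‖ ^ 5) ^ 2) t := by
    have hnum : HasDerivAt (fun t : ℝ => 9 * ‖w‖ ^ 4 * t) (9 * ‖w‖ ^ 4) t := ((hasDerivAt_id' t).const_mul (9 * ‖w‖ ^ 4)).congr_deriv (by ring)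
    have hden : HasDerivAt (fun t : ℝ => ‖u₀ + t • w‖ ^ 5) (5 * ‖u₀ + t • w‖ ^ 4 * (‖w‖ ^ 2 * t / ‖u₀ + t • w‖)) t :=
      ((hasDerivAt_norm_affine hu hw t).pow 5).congr_deriv (by norm_num)
    exact hnum.div hden (pow_ne_zero 5 hr)
  have hB : HasDerivAt (fun t : ℝ => 15 * ‖w‖ ^ 6 * t ^ 3 / ‖u₀ + t • w‖ ^ 7)
      ((15 * ‖w‖ ^ 6 * (3 * t ^ 2) * ‖u₀ + t • w‖ ^ 7 - 15 * ‖w‖ ^ 6 * t ^ 3 * (7 * ‖u₀ + t • w‖ ^ 6 * (‖w‖ ^ 2 * t / ‖u₀ + t • w‖))) /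
        (‖u₀ + t • w‖ ^ 7) ^ 2) t := by
    have hnum : HasDerivAt (fun t : ℝ => 15 * ‖w‖ ^ 6 * t ^ 3) (15 * ‖w‖ ^ 6 * (3 * t ^ 2)) t :=
      ((hasDerivAt_pow 3 t).const_mul (15 * ‖w‖ ^ 6)).congr_deriv (by norm_num)
    have hden : HasDerivAt (fun t : ℝ => ‖u₀ + t • w‖ ^ 7) (7 * ‖u₀ + t • w‖ ^ 6 * (‖w‖ ^ 2 * t / ‖u₀ + t • w‖)) t :=
      ((hasDerivAt_norm_affine hu hw t).pow 7).congr_deriv (by norm_num)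
    exact hnum.div hden (pow_ne_zero 7 hr)
  have h := hA.sub hB
  refine h.congr_deriv ?_
  field_simp
  ring

end Affine

/-! ## §2 The exact fourth norm -/

section Norms

variable {u₀ w : ℍ}

/-- ★ FOURTH jet: `‖4n‴ w + n⁗ (u₀ + t w)‖ ≤ 9(‖w‖/‖u₀‖)⁴` (indeed `‖q⁗‖² = 9‖u₀‖²‖w‖⁸(9A³ + 72A²X − 48AX² + 64X³)/r¹⁶`, `A = ‖u₀‖²`, `X = ‖w‖²t²`, and
`A⁵(9A³ + 72A²X − 48AX² + 64X³) ≤ 9(A + X)⁸`). [folklore] -/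
theorem norm_radialJet₄_le (hu : u₀ ≠ 0) (hw : ⟪u₀, w⟫ = 0) (t : ℝ) :
    ‖(4 * (9 * ‖w‖ ^ 4 * t / ‖u₀ + t • w‖ ^ 5 - 15 * ‖w‖ ^ 6 * t ^ 3 / ‖u₀ + t • w‖ ^ 7)) • w +
        (9 * ‖w‖ ^ 4 / ‖u₀ + t • w‖ ^ 5 - 90 * ‖w‖ ^ 6 * t ^ 2 / ‖u₀ + t • w‖ ^ 7 + 105 * ‖w‖ ^ 8 * t ^ 4 / ‖u₀ + t • w‖ ^ 9) • (u₀ + t • w)‖ ≤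
      9 * (‖w‖ / ‖u₀‖) ^ 4 := by
  have hr := norm_affine_pos hu hw t
  have hA := norm_pos_iff.2 hu
  set r := ‖u₀ + t • w‖ with hrdef
  set B := ‖w‖ ^ 2 with hBdef
  have hB4 : ‖w‖ ^ 4 = B ^ 2 := by rw [hBdef]; ring
  have hB6 : ‖w‖ ^ 6 = B ^ 3 := by rw [hBdef]; ring
  have hB8 : ‖w‖ ^ 8 = B ^ 4 := by rw [hBdef]; ring
  have hr2 : r ^ 2 = ‖u₀‖ ^ 2 + B * t ^ 2 := sq_norm_affine hw t
  have hB0 : 0 ≤ B := sq_nonneg _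
  set X := B * t ^ 2 with hXdef
  have hX0 : 0 ≤ X := by positivity
  have hsq : ‖(4 * (9 * B ^ 2 * t / r ^ 5 - 15 * B ^ 3 * t ^ 3 / r ^ 7)) • w + (9 * B ^ 2 / r ^ 5 - 90 * B ^ 3 * t ^ 2 / r ^ 7 + 105 * B ^ 4 * t ^ 4 / r ^ 9) •
      (u₀ + t • w)‖ ^ 2 = 9 * ‖u₀‖ ^ 2 * B ^ 4 * (9 * (‖u₀‖ ^ 2) ^ 3 + 72 * (‖u₀‖ ^ 2) ^ 2 * X - 48 * ‖u₀‖ ^ 2 * X ^ 2 + 64 * X ^ 3) / r ^ 16 := by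
    rw [sq_norm_smul_add_smul hw, ← hBdef, ← hrdef]
    have hu2 : ‖u₀‖ ^ 2 = r ^ 2 - B * t ^ 2 := by linarith
    rw [hu2, hXdef]; field_simp; ring
  have key : (‖u₀‖ ^ 2) ^ 5 * (9 * (‖u₀‖ ^ 2) ^ 3 + 72 * (‖u₀‖ ^ 2) ^ 2 * X - 48 * ‖u₀‖ ^ 2 * X ^ 2 + 64 * X ^ 3) ≤ 9 * r ^ 16 := by
    have e16 : r ^ 16 = (‖u₀‖ ^ 2 + X) ^ 8 := by rw [hXdef, ← hr2]; ring
    rw [e16]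
    set U := ‖u₀‖ ^ 2 with hU
    have hU0 : 0 ≤ U := sq_nonneg _
    have hexp : 9 * (U + X) ^ 8 - U ^ 5 * (9 * U ^ 3 + 72 * U ^ 2 * X - 48 * U * X ^ 2 + 64 * X ^ 3) =
        300 * U ^ 6 * X ^ 2 + 440 * U ^ 5 * X ^ 3 + 630 * U ^ 4 * X ^ 4 + 504 * U ^ 3 * X ^ 5 + 252 * U ^ 2 * X ^ 6 + 72 * U * X ^ 7 + 9 * X ^ 8 := by
      ring
    have hnn : 0 ≤ 300 * U ^ 6 * X ^ 2 + 440 * U ^ 5 * X ^ 3 + 630 * U ^ 4 * X ^ 4 + 504 * U ^ 3 * X ^ 5 + 252 * U ^ 2 * X ^ 6 + 72 * U * X ^ 7 +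
        9 * X ^ 8 := by positivity
    linarith
  have hle : ‖(4 * (9 * B ^ 2 * t / r ^ 5 - 15 * B ^ 3 * t ^ 3 / r ^ 7)) • w + (9 * B ^ 2 / r ^ 5 - 90 * B ^ 3 * t ^ 2 / r ^ 7 + 105 * B ^ 4 * t ^ 4 / r ^ 9) •
      (u₀ + t • w)‖ ^ 2 ≤ (9 * (‖w‖ / ‖u₀‖) ^ 4) ^ 2 := by
    rw [hsq, show (9 * (‖w‖ / ‖u₀‖) ^ 4) ^ 2 = 81 * B ^ 4 / (‖u₀‖ ^ 2) ^ 4 by rw [hBdef, mul_pow, div_pow, div_pow]; ring,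
      div_le_div_iff₀ (by positivity) (by positivity)]
    have hB4' : 0 ≤ 9 * B ^ 4 := by positivity
    calc 9 * ‖u₀‖ ^ 2 * B ^ 4 * (9 * (‖u₀‖ ^ 2) ^ 3 + 72 * (‖u₀‖ ^ 2) ^ 2 * X - 48 * ‖u₀‖ ^ 2 * X ^ 2 + 64 * X ^ 3) * (‖u₀‖ ^ 2) ^ 4 =
        9 * B ^ 4 * ((‖u₀‖ ^ 2) ^ 5 * (9 * (‖u₀‖ ^ 2) ^ 3 + 72 * (‖u₀‖ ^ 2) ^ 2 * X - 48 * ‖u₀‖ ^ 2 * X ^ 2 + 64 * X ^ 3)) := by ring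
      _ ≤ 9 * B ^ 4 * (9 * r ^ 16) := mul_le_mul_of_nonneg_left key hB4'
      _ = 81 * B ^ 4 * r ^ 16 := by ring
  rw [hB4, hB6, hB8]
  exact (pow_le_pow_iff_left₀ (norm_nonneg _) (by positivity) two_ne_zero).1 hle

end Norms

/-! ## §3 The radial projection of an affine line carries a 4-jet of size `‖w‖/‖u₀‖` -/

/-- `a•x + (a•x + (a•x + (a•x + b•y))) = (4a)•x + b•y`. [folklore] -/
theorem smul_add_smul_four (a b : ℝ) (x y : ℍ) : a • x + (a • x + (a • x + (a • x + b • y))) = (4 * a) • x + b • y := by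
  rw [show (4 : ℝ) * a = a + a + a + a by ring, add_smul, add_smul, add_smul]; abel

/-- ★★★ **THE RADIAL PROJECTION OF AN AFFINE LINE CARRIES A 4-JET OF SIZE `a = ‖w‖/‖u₀‖`**: for `u₀ ≠ 0` and `w ⊥ u₀` the path
`t ↦ radialUnit (u₀ + t • w)` has four derivatives everywhere with `‖q′‖ ≤ a`, `‖q″‖ ≤ a²`, `‖q‴‖ ≤ 3a³`, `‖q⁗‖ ≤ 9a⁴`, and norm `1`. [folklore] -/
theorem jet4_radialUnit_affine {u₀ w : ℍ} (hu : u₀ ≠ 0) (hw : ⟪u₀, w⟫ = 0) :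
    ∃ f₁ f₂ f₃ f₄ : ℝ → ℍ, (∀ t, HasDerivAt (fun t : ℝ => radialUnit (u₀ + t • w)) (f₁ t) t) ∧ (∀ t, HasDerivAt f₁ (f₂ t) t) ∧
      (∀ t, HasDerivAt f₂ (f₃ t) t) ∧ (∀ t, HasDerivAt f₃ (f₄ t) t) ∧
      ∀ t, ‖radialUnit (u₀ + t • w)‖ ≤ 1 ∧ ‖f₁ t‖ ≤ ‖w‖ / ‖u₀‖ ∧ ‖f₂ t‖ ≤ (‖w‖ / ‖u₀‖) ^ 2 ∧ ‖f₃ t‖ ≤ 3 * (‖w‖ / ‖u₀‖) ^ 3 ∧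
        ‖f₄ t‖ ≤ 9 * (‖w‖ / ‖u₀‖) ^ 4 := by
  have hd₀ := hasDerivAt_radialFactor₀ hu hw
  have hd₁ := hasDerivAt_radialFactor₁ hu hw
  have hd₂ := hasDerivAt_radialFactor₂ hu hw
  have hd₃ := hasDerivAt_radialFactor₃ hu hw
  have hu' : ∀ t, HasDerivAt (fun t : ℝ => u₀ + t • w) w t := hasDerivAt_affine u₀ w
  refine ⟨fun t => ‖u₀ + t • w‖⁻¹ • w + (-(‖w‖ ^ 2 * t) / ‖u₀ + t • w‖ ^ 3) • (u₀ + t • w),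
    fun t => (-(‖w‖ ^ 2 * t) / ‖u₀ + t • w‖ ^ 3) • w + ((-(‖w‖ ^ 2 * t) / ‖u₀ + t • w‖ ^ 3) • w +
      (-‖w‖ ^ 2 / ‖u₀ + t • w‖ ^ 3 + 3 * ‖w‖ ^ 4 * t ^ 2 / ‖u₀ + t • w‖ ^ 5) • (u₀ + t • w)),
    fun t => (-‖w‖ ^ 2 / ‖u₀ + t • w‖ ^ 3 + 3 * ‖w‖ ^ 4 * t ^ 2 / ‖u₀ + t • w‖ ^ 5) • w +
      ((-‖w‖ ^ 2 / ‖u₀ + t • w‖ ^ 3 + 3 * ‖w‖ ^ 4 * t ^ 2 / ‖u₀ + t • w‖ ^ 5) • w +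
        ((-‖w‖ ^ 2 / ‖u₀ + t • w‖ ^ 3 + 3 * ‖w‖ ^ 4 * t ^ 2 / ‖u₀ + t • w‖ ^ 5) • w +
          (9 * ‖w‖ ^ 4 * t / ‖u₀ + t • w‖ ^ 5 - 15 * ‖w‖ ^ 6 * t ^ 3 / ‖u₀ + t • w‖ ^ 7) • (u₀ + t • w))),
    fun t => (9 * ‖w‖ ^ 4 * t / ‖u₀ + t • w‖ ^ 5 - 15 * ‖w‖ ^ 6 * t ^ 3 / ‖u₀ + t • w‖ ^ 7) • w +
      ((9 * ‖w‖ ^ 4 * t / ‖u₀ + t • w‖ ^ 5 - 15 * ‖w‖ ^ 6 * t ^ 3 / ‖u₀ + t • w‖ ^ 7) • w +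
        ((9 * ‖w‖ ^ 4 * t / ‖u₀ + t • w‖ ^ 5 - 15 * ‖w‖ ^ 6 * t ^ 3 / ‖u₀ + t • w‖ ^ 7) • w +
          ((9 * ‖w‖ ^ 4 * t / ‖u₀ + t • w‖ ^ 5 - 15 * ‖w‖ ^ 6 * t ^ 3 / ‖u₀ + t • w‖ ^ 7) • w +
            (9 * ‖w‖ ^ 4 / ‖u₀ + t • w‖ ^ 5 - 90 * ‖w‖ ^ 6 * t ^ 2 / ‖u₀ + t • w‖ ^ 7 + 105 * ‖w‖ ^ 8 * t ^ 4 / ‖u₀ + t • w‖ ^ 9) • (u₀ + t • w)))),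
    fun t => ?_, fun t => ?_, fun t => ?_, fun t => ?_, fun t => ⟨?_, ?_, ?_, ?_, ?_⟩⟩
  · exact (hd₀ t).smul (hu' t)
  · exact ((hd₀ t).smul_const w).add ((hd₁ t).smul (hu' t))
  · exact ((hd₁ t).smul_const w).add (((hd₁ t).smul_const w).add ((hd₂ t).smul (hu' t)))
  · exact ((hd₂ t).smul_const w).add (((hd₂ t).smul_const w).add (((hd₂ t).smul_const w).add ((hd₃ t).smul (hu' t))))
  · exact (norm_radialUnit (norm_pos_iff.1 (norm_affine_pos hu hw t))).le
  · exact norm_radialJet₁_le hu hw t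
  · beta_reduce
    rw [smul_add_smul_two]
    exact norm_radialJet₂_le hu hw t
  · beta_reduce
    rw [smul_add_smul_three]
    exact norm_radialJet₃_le hu hw t
  · beta_reduce
    rw [smul_add_smul_four]
    exact norm_radialJet₄_le hu hw t

end Summit.QuantumFields.YangMills.Theorems.SwapVirialDeficit.Gnomonic

end
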